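import Literature.AnabelianGeometry.SemiGraphs.BTempQDPairQuotientFunctor
import Literature.AnabelianGeometry.SemiGraphs.QuasiTemperoidsQuotientConnectedProofs
import HarnessLib

/-!
# Semi-graphs of anabelioids, Appendix, proof of Theorem A.4: "`q_i((B, Γ_B))` is connected if and
# only if `(B, Γ_B)` is weakly connected" — UNCONDITIONAL for the model temperoid `B^temp(Π)`

Mochizuki, *Semi-graphs of anabelioids*, Publ. RIMS **42** (2006) 221–322, Appendix, proof of
Theorem A.4, manuscript p. 83 (PRIMS p. 313 ll. 2–3) [cite: MochizukiSemiAnbd2006, Thm A.4 proof p.83]: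
"one verifies immediately … that `q_i((B, Γ_B))` is connected if and only if `(B, Γ_B)` is weakly
connected".  Proof-only companion (no definitions) of `BTempQDPairQuotientFunctor.lean` (row A4-q of
`plan/L3/SUBDAG-SemiAnbd-Cor311.md`), where this clause was derived CONDITIONALLY on the
Definition A.3 (iii) bracket `QDPair.QuotientConnectedIffWeaklyConnected`
(`isConnectedObj_orbitQuotient_iff_of_fact`); that bracket has since been DISCHARGED by seat
abc-iut-w4-d048 (`QDPair.quotientConnectedIffWeaklyConnected_holds`,
`QuasiTemperoidsQuotientConnectedProofs.lean`), so the clause now holds outright for `Π` tempered: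
`QDPair.isConnectedObj_orbitQuotient_iff`.  Nothing refers to the IUT corpus; no side is taken on
any disputed claim.
-/

open CategoryTheory

namespace Literature.AnabelianGeometry.SemiGraphs

open Literature.AlgebraicGeometry.Frobenioids (IsConnectedObj)

universe u

namespace QDPair

variable {G : Type u} [Group G] [TopologicalSpace G] [IsTopologicalGroup G]

/-- **"`q_i((B, Γ_B))` is connected if and only if `(B, Γ_B)` is weakly connected"** for the orbit
quotient `B/Γ_B` of a QD-pair of `B^temp(Π)`, `Π` tempered — unconditional (the Def. A.3 (iii)
bracket it rests on is a theorem of the tree). [cite: MochizukiSemiAnbd2006, Thm A.4 proof p.83] -/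
theorem isConnectedObj_orbitQuotient_iff (hG : IsTempered G) (P : QDPair (BTemp G)) :
    IsConnectedObj P.orbitQuotient ↔ P.IsWeaklyConnected :=
  isConnectedObj_orbitQuotient_iff_of_fact hG QDPair.quotientConnectedIffWeaklyConnected_holds P

/-- In particular a quotient `B → C` (Def. A.3 (iii)) of a QD-pair `(B, Γ_B)` of `B^temp(Π)` has `C`
connected iff `(B, Γ_B)` is weakly connected (`B^temp(Π) = B^temp(Π)[Π/Π]` is a connected
quasi-temperoid). [cite: MochizukiSemiAnbd2006, Def A.3(iii) p.82] -/
theorem IsQuotient.isConnectedObj_iff (hG : IsTempered G) {P : QDPair (BTemp G)} {C : BTemp G}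
    {φ : P.A ⟶ C} (h : P.IsQuotient φ) : IsConnectedObj C ↔ P.IsWeaklyConnected :=
  QDPair.quotientConnectedIffWeaklyConnected_holds (BTemp G) (isConnectedQuasiTemperoid_bTemp hG)
    P φ h

end QDPair

end Literature.AnabelianGeometry.SemiGraphs
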